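import Mathlib
import Summits.CriticalPhenomena.Ising3DConformalLimit.Theses.PerfectScreening
import Summits.CriticalPhenomena.Ising3DConformalLimit.Theorems.PerfectScreeningSubharmonicOffOriginPskDefs
import Summits.CriticalPhenomena.Ising3DConformalLimit.Theorems.PerfectScreeningSubharmonicOffOriginHighTemperature

/-!
# Sketch — first lemmas of the two crux ideas filed by the strategist (stmt-CriticalPhenomena-1341)

* `BetheThreshold` — first lemma of idea `loop-o1-source-degree`: SubH_β at EVERY x ≠ 0 for the plus
  state whenever `tanh β ≤ 1/5` (the sharp graph-uniform = Bethe threshold `1/(2d−1)`), from the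
  x-deleted DLR expansion `ΔG·⟨2cosh βh_x⟩' = 2cosh⁶β Σ_{B⊂N(x), |B| odd} t^{|B|−1}(1−t)(|B|−(6−|B|)t)⟨σ₀σ_B⟩'`
  + Griffiths I in the deleted plus state. Improves the landed `highTemperature_subharmonicOffOrigin`
  (`tanh 2β ≤ 1/3`, i.e. `tanh β ≤ 3 − 2√2 = 0.1716`) to `tanh β ≤ 0.2` (β ≤ 0.2027 = 0.914 β_c).
* `YukawaLowerBound` — first lemma of idea `stieltjes-tauberian-far-field`: lattice Yukawa lower bound
  for the massive Green function `massiveGreen u` (landed object, PskDefs) uniformly in the mass window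
  `u ∈ (0,1]`: `massiveGreen u x ≥ c·e^{−C√u‖x‖}/‖x‖` for `x ≠ 0` — the input of the Tauberian step
  `f Stieltjes with σ(du) ≥ c u^{η/2−1}du on (0,1] ⇒ Lévy density of f∘p̂² ≳ ‖x‖^{-3-η}`.
Both are stated as `Prop`s (no sorry); they elaborate against the tree (rc 0).
-/

namespace Summit.CriticalPhenomena.Ising3DConformalLimit.Cruxes.SubharmonicOffOrigin.Strategist

open Literature.Probability.LatticeModels
open Summit.CriticalPhenomena.Ising3DConformalLimit.Theorems.PerfectScreening.Psk (massiveGreen)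

/-- First lemma of `loop-o1-source-degree`: the Bethe-threshold subharmonicity of the plus-state
two-point function of `ℤ³` (all `x ≠ 0`, all `β ≥ 0` with `tanh β ≤ 1/5`). -/
def BetheThreshold : Prop :=
  ∀ β : ℝ, 0 ≤ β → Real.tanh β ≤ 1 / 5 → ∀ x : Site 3, x ≠ 0 →
    6 * twoPointPlus 3 β x ≤ ∑ i : Fin 3, (twoPointPlus 3 β (x + Pi.single i 1) + twoPointPlus 3 β (x - Pi.single i 1))

/-- General-`d` form (the sharp graph-uniform threshold `tanh β ≤ 1/(2d−1)`). -/
def BetheThresholdGeneral : Prop :=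
  ∀ (d : ℕ), 1 ≤ d → ∀ β : ℝ, 0 ≤ β → Real.tanh β ≤ 1 / (2 * d - 1) → ∀ x : Site d, x ≠ 0 →
    2 * d * twoPointPlus d β x ≤ ∑ i : Fin d, (twoPointPlus d β (x + Pi.single i 1) + twoPointPlus d β (x - Pi.single i 1))

/-- First lemma of `stieltjes-tauberian-far-field`: uniform lattice Yukawa lower bound for the massive
Green function of `ℤ³` in the mass window `(0,1]`. -/
def YukawaLowerBound : Prop :=
  ∃ c C : ℝ, 0 < c ∧ 0 < C ∧ ∀ u : ℝ, 0 < u → u ≤ 1 → ∀ x : Site 3, x ≠ 0 →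
    c * Real.exp (-(C * Real.sqrt u * ‖x‖)) / ‖x‖ ≤ massiveGreen u x

/-- The Tauberian target it feeds (typed for the record): a Stieltjes measure with an `u^{η/2−1}` edge on
`(0,1]` produces a Lévy density `≳ ‖x‖^{-3-η}` through the massive Green functions. Stated with a finite
Riemann-sum lower bound to avoid Bochner-integrability binders. -/
def TauberianEdge : Prop :=
  ∀ η : ℝ, 0 < η → η < 1 → ∃ c : ℝ, 0 < c ∧ ∃ R : ℝ, ∀ x : Site 3, R < ‖x‖ →
    c * ‖x‖ ^ (-(3 : ℝ) - η) ≤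
      ∑ k ∈ Finset.range (Nat.floor (‖x‖ ^ (2 : ℝ))),
        ((k + 1 : ℝ) / ‖x‖ ^ (2 : ℝ)) ^ (η / 2) * (1 / ‖x‖ ^ (2 : ℝ)) *
          massiveGreen (((k + 1 : ℝ) / ‖x‖ ^ (2 : ℝ))) x

example : BetheThreshold → ∀ x : Site 3, x ≠ 0 →
    6 * twoPointPlus 3 0 x ≤ ∑ i : Fin 3, (twoPointPlus 3 0 (x + Pi.single i 1) + twoPointPlus 3 0 (x - Pi.single i 1)) :=
  fun h x hx => h 0 le_rfl (by simp) x hx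

end Summit.CriticalPhenomena.Ising3DConformalLimit.Cruxes.SubharmonicOffOrigin.Strategist
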